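import Summits.AtomisticToContinuum.Crystallization.Theorems.ChartedZeroExcessLayeredLatticeLiouvilleZZZYRCZL

/-!
# Charted zero-excess layered-lattice Liouville — ZZZYRCZM: the SLAB BOX and the LENGTH COMPARISON LEMMA

Cell `decomp-a2c`, lens 2, generation 100; line (D) TAIL-DEBIT of `UniformEquilStabilityAt`, work-list item 5 («box comparison lemmas»).
Every per-box reader of the line (ZZZYRCT `boxSchemeP_of_split`, ZZZYRCY `boxSchemeP_of_cover3`, ZZZYRCZL `boxSchemeP_of_cover3Box`,
the near reader ZZZYRCX/RCZ `thetaReaderNear_holds`) consumes the LENGTH COMPARISON `IdealLengthCmp wd λ μ (gen₁ L) (gen₂ L) w'`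
(`λ²·n9 ≤ 9‖e_x‖² ≤ μ²·n9` for every pair) as a box hypothesis; the census tables of record (R3-56 / ATLAS-D-56) list `(λ_B, μ_B)`
per box from the formula `λ_B = a_lo(1 − s − √(3/2)·τ')`, `μ_B = a_hi(1 + s + √(3/2)·τ')` (critic r1843).  This file makes the
comparison a LEMMA:

§1 ★ `SlabBoxW wd aLo aHi s τ hLo hHi L w'` — the typed SLAB BOX of a word: the chart is `s`-conformal about a scale `a ∈ [aLo, aHi]`
   (tree `IsConfChart`), and every layer step decomposes along a unit normal `n` of the chart plane as
   `w'(m+1) − w'(m) = ((reg(m+1) − reg m)/3)•(gen₁ L + gen₂ L) + r m + h m • n` with IN-PLANE SLIP `r m ⊥ n`, `‖r m‖ ≤ τ·a` and HEIGHT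
   `h m ∈ [hLo·a, hHi·a]` (registry letters `reg = regW wd` of ZZZYRCX; `hLo ≤ ρ_lo·√(2/3)`, `hHi ≥ ρ_hi·√(2/3)` rational roundings chosen by
   the table; slip DIRECTION is not boxed — the length comparison does not need it);
§2 geometry: `‖A t₁ + B t₂‖² = A² + AB + B²`, the two-sided norm bounds of an `s`-conformal chart, Pythagoras along `n`, the telescoped
   layer steps and their bounds, and the decomposition of an upward bond vector `e_x = (L v + R) + H•n` (`v` the ideal in-plane vector with
   `9‖v‖² = qhex(ΔR)`, `R` the slip total, `H` the height total), `n9 = 9‖v‖² + 6Δm²`;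
§3 the real cores: with `X = ‖v‖`, `Y = Δm`, `U = ‖L v + R‖ ∈ [a(1−s)X − τaY, a(1+s)X + τaY]`, `H ∈ [hLo·a·Y, hHi·a·Y]`, the bounds
   `λ²(X² + ⅔Y²) ≤ U² + H² ≤ μ²(X² + ⅔Y²)` follow from FIVE CLOSED-FORM POLYNOMIAL CHECKS on `(aLo, aHi, s, τ, hLo, hHi, λ, μ)` —
   positive semidefiniteness of two binary forms plus the column case `(1−s)X < τY` — each decidable by `norm_num` on the rationals;
§4 ★★ `idealLengthCmp_of_slabBox : SlabBoxW … L w' → (checks) → IdealLengthCmp wd λ μ (gen₁ L) (gen₂ L) w'` (downward pairs by symmetry);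
§5 corollaries for the readers: the per-box co-Lipschitz constant (`isLayeredCrystal_of_slabBox`, via ZZZYRCZL) and the generator norms
   `‖gen_i L‖ ≤ (1+s)·aHi` (the `hgen` side condition).
Numbers (memo NODE-g100 §8): the ATLAS-D-56 cell `P 0.8602, ρ_h 0.94, slip 0` (`a ∈ [0.8602, 0.8701]`, `ρ ∈ [0.923, 0.955]`, `τ = 0.0175`,
`hLo = 0.7536`, `hHi = 0.7798`, `s = 1/50`) passes all five checks at the table's `(λ_B, μ_B) = (0.77424, 0.95705)` (evidence DOCK_RCZM); the
binding check is the column case (`λ ≤ ρ_lo·a_lo` up to `τ`), with 5 % room.  All dials are parameters.  Proof file, 0 sorry; imports ZZZYRCZL.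
[g100]
-/

namespace Summit.AtomisticToContinuum.Crystallization.Theorems.ChartedZeroExcessLayeredLatticeLiouville

open scoped BigOperators RealInnerProductSpace
open Literature.MathematicalPhysics.StatisticalMechanics (triangularVec₁ triangularVec₂)
open Summit.AtomisticToContinuum.Crystallization.Theorems.ChartedPlanarOrderRigidityDoor (E3)

/-! ### §1 the slab box -/

/-- ★ THE SLAB BOX of the word `wd`: conformal chart at a scale `a ∈ [aLo, aHi]`, a unit normal `n` of the chart plane, and per layer an
in-plane slip `r m` (`‖r m‖ ≤ τa`) and a height `h m ∈ [hLo·a, hHi·a]` such that the layer step is the ideal registry shift plus slip plus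
height.  The shape JSBOX-SOUND has to deliver for every admissible word (memo NODE-g99 §2(h)). [g100] -/
def SlabBoxW (wd : List ℤ) (aLo aHi s τ hLo hHi : ℝ) (L : E3 ≃L[ℝ] E3) (w : ℤ → E3) : Prop :=
  ∃ (a : ℝ) (n : E3) (r : ℤ → E3) (h : ℤ → ℝ), aLo ≤ a ∧ a ≤ aHi ∧ IsConfChart a s (L : E3 →L[ℝ] E3) ∧ ‖n‖ = 1 ∧
    ⟪gen₁ L, n⟫ = 0 ∧ ⟪gen₂ L, n⟫ = 0 ∧ (∀ m, ‖r m‖ ≤ τ * a) ∧ (∀ m, hLo * a ≤ h m ∧ h m ≤ hHi * a) ∧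
    (∀ m, ⟪r m, n⟫ = 0) ∧
    ∀ m : ℤ, w (m + 1) - w m = (((regW wd (m + 1) : ℝ) - regW wd m) / 3) • (gen₁ L + gen₂ L) + r m + h m • n

/-! ### §2 geometry of the decomposition -/

/-- `‖A t₁ + B t₂‖² = A² + AB + B²` for the unit triangular generators. [g100] -/
theorem normSq_triangular_comb (A B : ℝ) :
    ‖A • (triangularVec₁ (1 : ℝ) : E3) + B • triangularVec₂ 1‖ ^ 2 = A ^ 2 + A * B + B ^ 2 := by
  rw [EuclideanSpace.norm_eq, Real.sq_sqrt (by positivity)]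
  simp [Fin.sum_univ_three, triangularVec₁, triangularVec₂]
  have h3 : Real.sqrt 3 ^ 2 = 3 := Real.sq_sqrt (by norm_num)
  nlinarith [h3]

/-- two-sided norm bounds of an `s`-conformal chart about the scale `a ≥ 0`: `a(1−s)‖v‖ ≤ ‖L v‖ ≤ a(1+s)‖v‖`. [g100] -/
theorem norm_map_bounds_of_isConfChart {a s : ℝ} {L : E3 →L[ℝ] E3} (ha : 0 ≤ a) (hL : IsConfChart a s L) (v : E3) :
    (a - s * a) * ‖v‖ ≤ ‖L v‖ ∧ ‖L v‖ ≤ (a + s * a) * ‖v‖ := by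
  obtain ⟨Q, hQ⟩ := hL
  set M : E3 →L[ℝ] E3 := (Q.toContinuousLinearEquiv : E3 →L[ℝ] E3) with hM
  have h1 : ‖(L - a • M) v‖ ≤ s * a * ‖v‖ :=
    (ContinuousLinearMap.le_opNorm _ _).trans (mul_le_mul_of_nonneg_right hQ (norm_nonneg _))
  have h2 : ‖a • (M v)‖ = a * ‖v‖ := by
    rw [norm_smul, Real.norm_of_nonneg ha, hM]; simp
  have hsub : (L - a • M) v = L v - a • (M v) := by simp
  rw [hsub] at h1
  have h3 := norm_sub_norm_le (a • M v) (L v)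
  have h4 := norm_sub_norm_le (L v) (a • M v)
  rw [norm_sub_rev] at h3
  constructor <;> nlinarith [h1, h2, h3, h4]

/-- Pythagoras along the normal: `‖u + H•n‖² = ‖u‖² + H²` for `u ⊥ n`, `‖n‖ = 1`. [g100] -/
theorem normSq_add_smul_of_inner_zero (u n : E3) (H : ℝ) (hn : ‖n‖ = 1) (hu : ⟪u, n⟫ = 0) :
    ‖u + H • n‖ ^ 2 = ‖u‖ ^ 2 + H ^ 2 := by
  rw [norm_add_sq_real, real_inner_smul_right, hu, norm_smul, hn, Real.norm_eq_abs, mul_one, sq_abs]; ring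

/-- telescoping of `d` layer steps above layer `m`. [g100] -/
theorem layerSteps_sum (w r : ℤ → E3) (h ρ : ℤ → ℝ) (g n : E3)
    (hstep : ∀ m, w (m + 1) - w m = ((ρ (m + 1) - ρ m) / 3) • g + r m + h m • n) (m : ℤ) (d : ℕ) :
    w (m + d) - w m = ((ρ (m + d) - ρ m) / 3) • g + ∑ k ∈ Finset.range d, r (m + k) +
      (∑ k ∈ Finset.range d, h (m + k)) • n := by
  induction d with
  | zero => simp
  | succ d ih =>
    have hsplit : w (m + ((d + 1 : ℕ) : ℤ)) - w m = (w (m + d + 1) - w (m + d)) + (w (m + d) - w m) := by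
      rw [Nat.cast_succ, ← add_assoc]; abel
    have hρ : (ρ (m + ((d + 1 : ℕ) : ℤ)) - ρ m) / 3 = (ρ (m + d + 1) - ρ (m + d)) / 3 + (ρ (m + d) - ρ m) / 3 := by
      rw [Nat.cast_succ, ← add_assoc]; ring
    rw [hsplit, hstep (m + d), ih, Finset.sum_range_succ, Finset.sum_range_succ, hρ, add_smul, add_smul]
    abel

/-- bounds of the telescoped slips and heights: `‖Σ r‖ ≤ d·τa`, `Σ h ∈ [d·hLo·a, d·hHi·a]`. [g100] -/
theorem layerSteps_bounds {r : ℤ → E3} {h : ℤ → ℝ} {τ a hLo hHi : ℝ}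
    (hr : ∀ m, ‖r m‖ ≤ τ * a) (hh : ∀ m, hLo * a ≤ h m ∧ h m ≤ hHi * a) (m : ℤ) (d : ℕ) :
    ‖∑ k ∈ Finset.range d, r (m + k)‖ ≤ d * (τ * a) ∧ d * (hLo * a) ≤ ∑ k ∈ Finset.range d, h (m + k) ∧
      ∑ k ∈ Finset.range d, h (m + k) ≤ d * (hHi * a) := by
  refine ⟨?_, ?_, ?_⟩
  · calc ‖∑ k ∈ Finset.range d, r (m + k)‖ ≤ ∑ k ∈ Finset.range d, ‖r (m + k)‖ := norm_sum_le _ _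
      _ ≤ ∑ k ∈ Finset.range d, τ * a := Finset.sum_le_sum fun k _ => hr (m + k)
      _ = d * (τ * a) := by simp
  · calc (d : ℝ) * (hLo * a) = ∑ k ∈ Finset.range d, hLo * a := by simp
      _ ≤ ∑ k ∈ Finset.range d, h (m + k) := Finset.sum_le_sum fun k _ => (hh (m + k)).1
  · calc ∑ k ∈ Finset.range d, h (m + k) ≤ ∑ k ∈ Finset.range d, hHi * a := Finset.sum_le_sum fun k _ => (hh (m + k)).2
      _ = d * (hHi * a) := by simp

/-- DECOMPOSITION of the bond vector of an upward pair (`x.2.2 = x.1.2 + d`): chart image of the ideal in-plane vector + slip total +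
height total along the normal. [g100] -/
theorem bondVec_decomp_of_steps {wd : List ℤ} {L : E3 ≃L[ℝ] E3} {w r : ℤ → E3} {h : ℤ → ℝ} {n : E3}
    (hstep : ∀ m : ℤ, w (m + 1) - w m = (((regW wd (m + 1) : ℝ) - regW wd m) / 3) • (gen₁ L + gen₂ L) + r m + h m • n)
    (x : (Cell 2 × ℤ) × (Cell 2 × ℤ)) (d : ℕ) (hd : x.2.2 = x.1.2 + d) :
    bondVec (gen₁ L) (gen₂ L) w x =
      (L : E3 →L[ℝ] E3) ((((refW0 wd x.2 - refW0 wd x.1 : ℤ) : ℝ) / 3) • triangularVec₁ 1 +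
          (((refW1 wd x.2 - refW1 wd x.1 : ℤ) : ℝ) / 3) • triangularVec₂ 1) +
        ∑ k ∈ Finset.range d, r (x.1.2 + k) + (∑ k ∈ Finset.range d, h (x.1.2 + k)) • n := by
  have hw := layerSteps_sum w r h (fun m => (regW wd m : ℝ)) (gen₁ L + gen₂ L) n hstep x.1.2 d
  beta_reduce at hw
  rw [← hd] at hw
  have hb : bondVec (gen₁ L) (gen₂ L) w x = ((x.2.1 0 : ℝ) - x.1.1 0) • gen₁ L + ((x.2.1 1 : ℝ) - x.1.1 1) • gen₂ L +
      (w x.2.2 - w x.1.2) := by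
    simp only [bondVec, lsite, sub_smul]; abel
  have hL : (L : E3 →L[ℝ] E3) ((((refW0 wd x.2 - refW0 wd x.1 : ℤ) : ℝ) / 3) • triangularVec₁ 1 +
      (((refW1 wd x.2 - refW1 wd x.1 : ℤ) : ℝ) / 3) • triangularVec₂ 1) =
      (((refW0 wd x.2 - refW0 wd x.1 : ℤ) : ℝ) / 3) • gen₁ L + (((refW1 wd x.2 - refW1 wd x.1 : ℤ) : ℝ) / 3) • gen₂ L := by
    simp [gen₁, gen₂]
  have e₀ : ((refW0 wd x.2 - refW0 wd x.1 : ℤ) : ℝ) / 3 =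
      ((x.2.1 0 : ℝ) - x.1.1 0) + ((regW wd x.2.2 : ℝ) - regW wd x.1.2) / 3 := by
    push_cast [refW0]; ring
  have e₁ : ((refW1 wd x.2 - refW1 wd x.1 : ℤ) : ℝ) / 3 =
      ((x.2.1 1 : ℝ) - x.1.1 1) + ((regW wd x.2.2 : ℝ) - regW wd x.1.2) / 3 := by
    push_cast [refW1]; ring
  rw [hb, hw, hL, e₀, e₁, add_smul, add_smul, smul_add]
  abel

/-- `n9W` is symmetric under swapping the pair. [g100] -/
theorem n9W_swap (wd : List ℤ) (x : (Cell 2 × ℤ) × (Cell 2 × ℤ)) : n9W wd (x.2, x.1) = n9W wd x := by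
  simp only [n9W]; ring

/-- the bond length is symmetric under swapping the pair. [g100] -/
theorem norm_bondVec_swap (a b : E3) (w : ℤ → E3) (x : (Cell 2 × ℤ) × (Cell 2 × ℤ)) :
    ‖bondVec a b w (x.2, x.1)‖ = ‖bondVec a b w x‖ := by
  simp only [bondVec]; exact norm_sub_rev _ _

/-! ### §3 the real cores (five polynomial checks) -/

/-- a binary form `A X² − 2B XY + C Y²` with `A > 0`, `B² ≤ AC` is nonnegative. [g100] -/
theorem psdForm_nonneg {A B C : ℝ} (hA : 0 < A) (hAC : B ^ 2 ≤ A * C) (X Y : ℝ) :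
    0 ≤ A * X ^ 2 - 2 * B * X * Y + C * Y ^ 2 := by
  have hid : A * (A * X ^ 2 - 2 * B * X * Y + C * Y ^ 2) = (A * X - B * Y) ^ 2 + (A * C - B ^ 2) * Y ^ 2 := by ring
  have h : 0 ≤ A * (A * X ^ 2 - 2 * B * X * Y + C * Y ^ 2) := by
    rw [hid]; exact add_nonneg (sq_nonneg _) (mul_nonneg (sub_nonneg.2 hAC) (sq_nonneg _))
  exact (mul_nonneg_iff_of_pos_left hA).1 h

/-- LOWER core: checks `λ² < (1−s)²aLo²` (A), `(1−s)²τ²aLo⁴ ≤ ((1−s)²aLo² − λ²)((τ²+hLo²)aLo² − ⅔λ²)` (AC) and the COLUMN CASE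
`λ²(τ² + ⅔(1−s)²) ≤ hLo²(1−s)²aLo²` (C2) give `λ²(X² + ⅔Y²) ≤ U² + H²`. [g100] -/
theorem lengthCmp_lower_core {aLo a s τ hLo lam X Y U H : ℝ} (haLo : 0 < aLo) (haa : aLo ≤ a) (hs : s < 1)
    (hhLo : 0 ≤ hLo) (hX : 0 ≤ X) (hY : 0 ≤ Y) (_hU0 : 0 ≤ U)
    (hU : (a - s * a) * X - τ * a * Y ≤ U) (hH : hLo * a * Y ≤ H)
    (hA : lam ^ 2 < (1 - s) ^ 2 * aLo ^ 2)
    (hAC : (1 - s) ^ 2 * τ ^ 2 * aLo ^ 4 ≤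
      ((1 - s) ^ 2 * aLo ^ 2 - lam ^ 2) * ((τ ^ 2 + hLo ^ 2) * aLo ^ 2 - 2 / 3 * lam ^ 2))
    (hC2 : lam ^ 2 * (τ ^ 2 + 2 / 3 * (1 - s) ^ 2) ≤ hLo ^ 2 * (1 - s) ^ 2 * aLo ^ 2) :
    lam ^ 2 * (X ^ 2 + 2 / 3 * Y ^ 2) ≤ U ^ 2 + H ^ 2 := by
  have hσ : 0 < 1 - s := by linarith
  have hH' : hLo * aLo * Y ≤ H :=
    le_trans (mul_le_mul_of_nonneg_right (mul_le_mul_of_nonneg_left haa hhLo) hY) hH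
  have hH2 : (hLo * aLo * Y) ^ 2 ≤ H ^ 2 := pow_le_pow_left₀ (by positivity) hH' 2
  rcases le_or_gt (τ * Y) ((1 - s) * X) with h1 | h1
  · have hb : 0 ≤ (1 - s) * X - τ * Y := by linarith
    have hU' : aLo * ((1 - s) * X - τ * Y) ≤ U := by
      have e : (a - s * a) * X - τ * a * Y = a * ((1 - s) * X - τ * Y) := by ring
      rw [e] at hU
      exact le_trans (mul_le_mul_of_nonneg_right haa hb) hU
    have hU2 : (aLo * ((1 - s) * X - τ * Y)) ^ 2 ≤ U ^ 2 := pow_le_pow_left₀ (by positivity) hU' 2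
    have hApos : 0 < (1 - s) ^ 2 * aLo ^ 2 - lam ^ 2 := by linarith
    have hdisc : ((1 - s) * τ * aLo ^ 2) ^ 2 ≤
        ((1 - s) ^ 2 * aLo ^ 2 - lam ^ 2) * ((τ ^ 2 + hLo ^ 2) * aLo ^ 2 - 2 / 3 * lam ^ 2) := by
      have e : ((1 - s) * τ * aLo ^ 2) ^ 2 = (1 - s) ^ 2 * τ ^ 2 * aLo ^ 4 := by ring
      rw [e]; exact hAC
    have hQ := psdForm_nonneg hApos hdisc X Y
    have hid : lam ^ 2 * (X ^ 2 + 2 / 3 * Y ^ 2) = (aLo * ((1 - s) * X - τ * Y)) ^ 2 + (hLo * aLo * Y) ^ 2 -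
        (((1 - s) ^ 2 * aLo ^ 2 - lam ^ 2) * X ^ 2 - 2 * ((1 - s) * τ * aLo ^ 2) * X * Y +
          ((τ ^ 2 + hLo ^ 2) * aLo ^ 2 - 2 / 3 * lam ^ 2) * Y ^ 2) := by ring
    rw [hid]; linarith
  · have h1' : ((1 - s) * X) ^ 2 ≤ (τ * Y) ^ 2 := pow_le_pow_left₀ (by positivity) h1.le 2
    have hkey : lam ^ 2 * (X ^ 2 + 2 / 3 * Y ^ 2) * (1 - s) ^ 2 ≤ (hLo * aLo * Y) ^ 2 * (1 - s) ^ 2 := by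
      have e1 : lam ^ 2 * (X ^ 2 + 2 / 3 * Y ^ 2) * (1 - s) ^ 2 =
          lam ^ 2 * (((1 - s) * X) ^ 2 + 2 / 3 * (1 - s) ^ 2 * Y ^ 2) := by ring
      rw [e1]
      calc lam ^ 2 * (((1 - s) * X) ^ 2 + 2 / 3 * (1 - s) ^ 2 * Y ^ 2)
          ≤ lam ^ 2 * ((τ * Y) ^ 2 + 2 / 3 * (1 - s) ^ 2 * Y ^ 2) :=
            mul_le_mul_of_nonneg_left (by linarith) (sq_nonneg _)
        _ = lam ^ 2 * (τ ^ 2 + 2 / 3 * (1 - s) ^ 2) * Y ^ 2 := by ring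
        _ ≤ hLo ^ 2 * (1 - s) ^ 2 * aLo ^ 2 * Y ^ 2 := mul_le_mul_of_nonneg_right hC2 (sq_nonneg _)
        _ = (hLo * aLo * Y) ^ 2 * (1 - s) ^ 2 := by ring
    have := le_of_mul_le_mul_right hkey (pow_pos hσ 2)
    nlinarith [sq_nonneg U]

/-- UPPER core: checks `(1+s)²aHi² < μ²` (A') and `(1+s)²τ²aHi⁴ ≤ (μ² − (1+s)²aHi²)(⅔μ² − (τ²+hHi²)aHi²)` (AC') give
`U² + H² ≤ μ²(X² + ⅔Y²)`. [g100] -/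
theorem lengthCmp_upper_core {aHi a s τ hHi mu X Y U H : ℝ} (haa : a ≤ aHi) (hs : 0 ≤ s)
    (hτ : 0 ≤ τ) (hhHi : 0 ≤ hHi) (hX : 0 ≤ X) (hY : 0 ≤ Y) (hU0 : 0 ≤ U)
    (hU : U ≤ (a + s * a) * X + τ * a * Y) (hH0 : 0 ≤ H) (hH : H ≤ hHi * a * Y)
    (hA : (1 + s) ^ 2 * aHi ^ 2 < mu ^ 2)
    (hAC : (1 + s) ^ 2 * τ ^ 2 * aHi ^ 4 ≤
      (mu ^ 2 - (1 + s) ^ 2 * aHi ^ 2) * (2 / 3 * mu ^ 2 - (τ ^ 2 + hHi ^ 2) * aHi ^ 2)) :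
    U ^ 2 + H ^ 2 ≤ mu ^ 2 * (X ^ 2 + 2 / 3 * Y ^ 2) := by
  have hW0 : 0 ≤ (1 + s) * X + τ * Y := by positivity
  have hU' : U ≤ aHi * ((1 + s) * X + τ * Y) := by
    have e : (a + s * a) * X + τ * a * Y = a * ((1 + s) * X + τ * Y) := by ring
    rw [e] at hU
    exact le_trans hU (mul_le_mul_of_nonneg_right haa hW0)
  have hU2 : U ^ 2 ≤ (aHi * ((1 + s) * X + τ * Y)) ^ 2 := pow_le_pow_left₀ hU0 hU' 2
  have hH' : H ≤ hHi * aHi * Y :=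
    le_trans hH (mul_le_mul_of_nonneg_right (mul_le_mul_of_nonneg_left haa hhHi) hY)
  have hH2 : H ^ 2 ≤ (hHi * aHi * Y) ^ 2 := pow_le_pow_left₀ hH0 hH' 2
  have hApos : 0 < mu ^ 2 - (1 + s) ^ 2 * aHi ^ 2 := by linarith
  have hdisc : ((1 + s) * τ * aHi ^ 2) ^ 2 ≤
      (mu ^ 2 - (1 + s) ^ 2 * aHi ^ 2) * (2 / 3 * mu ^ 2 - (τ ^ 2 + hHi ^ 2) * aHi ^ 2) := by
    have e : ((1 + s) * τ * aHi ^ 2) ^ 2 = (1 + s) ^ 2 * τ ^ 2 * aHi ^ 4 := by ring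
    rw [e]; exact hAC
  have hQ := psdForm_nonneg hApos hdisc X Y
  have hid : mu ^ 2 * (X ^ 2 + 2 / 3 * Y ^ 2) = (aHi * ((1 + s) * X + τ * Y)) ^ 2 + (hHi * aHi * Y) ^ 2 +
      ((mu ^ 2 - (1 + s) ^ 2 * aHi ^ 2) * X ^ 2 - 2 * ((1 + s) * τ * aHi ^ 2) * X * Y +
        (2 / 3 * mu ^ 2 - (τ ^ 2 + hHi ^ 2) * aHi ^ 2) * Y ^ 2) := by ring
  rw [hid]; linarith

/-! ### §4 the length comparison -/

/-- the two comparisons for an UPWARD pair (`x.1.2 ≤ x.2.2`), from the unpacked slab-box data. [g100] -/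
theorem lengthCmp_pair_of_steps {wd : List ℤ} {aLo aHi s τ hLo hHi lam mu a : ℝ} {L : E3 ≃L[ℝ] E3} {w r : ℤ → E3}
    {h : ℤ → ℝ} {n : E3} (haLo : 0 < aLo) (haLo' : aLo ≤ a) (haHi' : a ≤ aHi) (hs0 : 0 ≤ s) (hs1 : s < 1) (hτ : 0 ≤ τ)
    (hhLo : 0 ≤ hLo) (hhHi : 0 ≤ hHi) (hconf : IsConfChart a s (L : E3 →L[ℝ] E3)) (hn : ‖n‖ = 1)
    (hg₁ : ⟪gen₁ L, n⟫ = 0) (hg₂ : ⟪gen₂ L, n⟫ = 0) (hr : ∀ m, ‖r m‖ ≤ τ * a) (hh : ∀ m, hLo * a ≤ h m ∧ h m ≤ hHi * a)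
    (hrn : ∀ m, ⟪r m, n⟫ = 0)
    (hstep : ∀ m : ℤ, w (m + 1) - w m = (((regW wd (m + 1) : ℝ) - regW wd m) / 3) • (gen₁ L + gen₂ L) + r m + h m • n)
    (hA : lam ^ 2 < (1 - s) ^ 2 * aLo ^ 2)
    (hAC : (1 - s) ^ 2 * τ ^ 2 * aLo ^ 4 ≤
      ((1 - s) ^ 2 * aLo ^ 2 - lam ^ 2) * ((τ ^ 2 + hLo ^ 2) * aLo ^ 2 - 2 / 3 * lam ^ 2))
    (hC2 : lam ^ 2 * (τ ^ 2 + 2 / 3 * (1 - s) ^ 2) ≤ hLo ^ 2 * (1 - s) ^ 2 * aLo ^ 2)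
    (hA' : (1 + s) ^ 2 * aHi ^ 2 < mu ^ 2)
    (hAC' : (1 + s) ^ 2 * τ ^ 2 * aHi ^ 4 ≤
      (mu ^ 2 - (1 + s) ^ 2 * aHi ^ 2) * (2 / 3 * mu ^ 2 - (τ ^ 2 + hHi ^ 2) * aHi ^ 2))
    (x : (Cell 2 × ℤ) × (Cell 2 × ℤ)) (hle : x.1.2 ≤ x.2.2) :
    lam ^ 2 * (n9W wd x : ℝ) ≤ 9 * ‖bondVec (gen₁ L) (gen₂ L) w x‖ ^ 2 ∧
      9 * ‖bondVec (gen₁ L) (gen₂ L) w x‖ ^ 2 ≤ mu ^ 2 * (n9W wd x : ℝ) := by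
  have ha : 0 ≤ a := haLo.le.trans haLo'
  obtain ⟨d, hdℤ⟩ : ∃ d : ℕ, ((d : ℕ) : ℤ) = x.2.2 - x.1.2 := ⟨_, Int.toNat_of_nonneg (sub_nonneg.2 hle)⟩
  have hd : x.2.2 = x.1.2 + d := by rw [hdℤ]; ring
  have hdℝ : ((d : ℕ) : ℝ) = (x.2.2 : ℝ) - x.1.2 := by exact_mod_cast hdℤ
  -- the decomposition `e = (L v + R) + H • n`
  have hdec := bondVec_decomp_of_steps hstep x d hd
  set c₀ : ℝ := ((refW0 wd x.2 - refW0 wd x.1 : ℤ) : ℝ) / 3 with hc₀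
  set c₁ : ℝ := ((refW1 wd x.2 - refW1 wd x.1 : ℤ) : ℝ) / 3 with hc₁
  set v : E3 := c₀ • triangularVec₁ 1 + c₁ • triangularVec₂ 1 with hv
  set R : E3 := ∑ k ∈ Finset.range d, r (x.1.2 + k) with hR
  set H : ℝ := ∑ k ∈ Finset.range d, h (x.1.2 + k) with hH
  -- orthogonality and Pythagoras
  have hLv : (L : E3 →L[ℝ] E3) v = c₀ • gen₁ L + c₁ • gen₂ L := by simp [hv, gen₁, gen₂]
  have horth : ⟪(L : E3 →L[ℝ] E3) v + R, n⟫ = 0 := by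
    rw [inner_add_left, hLv, inner_add_left, real_inner_smul_left, real_inner_smul_left, hg₁, hg₂, hR, sum_inner]
    simp [hrn]
  have hsq : ‖bondVec (gen₁ L) (gen₂ L) w x‖ ^ 2 = ‖(L : E3 →L[ℝ] E3) v + R‖ ^ 2 + H ^ 2 := by
    rw [hdec]; exact normSq_add_smul_of_inner_zero _ _ _ hn horth
  -- the ideal quantities: `n9 = 9‖v‖² + 6d²`
  have hX2 : ‖v‖ ^ 2 = c₀ ^ 2 + c₀ * c₁ + c₁ ^ 2 := by rw [hv]; exact normSq_triangular_comb c₀ c₁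
  have hn9 : (n9W wd x : ℝ) = 9 * ‖v‖ ^ 2 + 6 * (d : ℝ) ^ 2 := by
    rw [hX2, hc₀, hc₁, hdℝ]; simp only [n9W]; push_cast; ring
  -- bounds on `U = ‖L v + R‖` and on `H`
  obtain ⟨hRle, hHlo, hHhi⟩ := layerSteps_bounds hr hh x.1.2 d
  have hLvb := norm_map_bounds_of_isConfChart ha hconf v
  have hU_lo : (a - s * a) * ‖v‖ - τ * a * d ≤ ‖(L : E3 →L[ℝ] E3) v + R‖ := by
    have h1 : ‖((L : E3 →L[ℝ] E3) v + R) - R‖ ≤ ‖(L : E3 →L[ℝ] E3) v + R‖ + ‖R‖ := norm_sub_le _ _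
    rw [add_sub_cancel_right] at h1
    linarith [hLvb.1]
  have hU_hi : ‖(L : E3 →L[ℝ] E3) v + R‖ ≤ (a + s * a) * ‖v‖ + τ * a * d := by
    have h1 := norm_add_le ((L : E3 →L[ℝ] E3) v) R
    linarith [hLvb.2]
  have hH_lo : hLo * a * d ≤ H := by rw [hH]; linarith
  have hH_hi : H ≤ hHi * a * d := by rw [hH]; linarith
  have hH0 : 0 ≤ H := le_trans (by positivity) hH_lo
  have hlow := lengthCmp_lower_core (X := ‖v‖) (Y := (d : ℝ)) haLo haLo' hs1 hhLo (norm_nonneg _) (by positivity)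
    (norm_nonneg _) hU_lo hH_lo hA hAC hC2
  have hupp := lengthCmp_upper_core (X := ‖v‖) (Y := (d : ℝ)) haHi' hs0 hτ hhHi (norm_nonneg _) (by positivity)
    (norm_nonneg _) hU_hi hH0 hH_hi hA' hAC'
  rw [hn9, hsq]
  constructor
  · linear_combination (9 : ℝ) * hlow
  · linear_combination (9 : ℝ) * hupp

/-- ★★ THE LENGTH COMPARISON LEMMA: a word in the slab box satisfies `IdealLengthCmp wd λ μ (gen₁ L) (gen₂ L) w` for every `(λ, μ)`
passing the five closed-form polynomial checks (decidable by `norm_num` on the box rationals). [g100] -/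
theorem idealLengthCmp_of_slabBox {wd : List ℤ} {aLo aHi s τ hLo hHi lam mu : ℝ} {L : E3 ≃L[ℝ] E3} {w : ℤ → E3}
    (hB : SlabBoxW wd aLo aHi s τ hLo hHi L w) (haLo : 0 < aLo) (hs0 : 0 ≤ s) (hs1 : s < 1) (hτ : 0 ≤ τ)
    (hhLo : 0 ≤ hLo) (hhHi : 0 ≤ hHi)
    (hA : lam ^ 2 < (1 - s) ^ 2 * aLo ^ 2)
    (hAC : (1 - s) ^ 2 * τ ^ 2 * aLo ^ 4 ≤
      ((1 - s) ^ 2 * aLo ^ 2 - lam ^ 2) * ((τ ^ 2 + hLo ^ 2) * aLo ^ 2 - 2 / 3 * lam ^ 2))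
    (hC2 : lam ^ 2 * (τ ^ 2 + 2 / 3 * (1 - s) ^ 2) ≤ hLo ^ 2 * (1 - s) ^ 2 * aLo ^ 2)
    (hA' : (1 + s) ^ 2 * aHi ^ 2 < mu ^ 2)
    (hAC' : (1 + s) ^ 2 * τ ^ 2 * aHi ^ 4 ≤
      (mu ^ 2 - (1 + s) ^ 2 * aHi ^ 2) * (2 / 3 * mu ^ 2 - (τ ^ 2 + hHi ^ 2) * aHi ^ 2)) :
    IdealLengthCmp wd lam mu (gen₁ L) (gen₂ L) w := by
  obtain ⟨a, n, r, h, haLo', haHi', hconf, hn, hg₁, hg₂, hr, hh, hrn, hstep⟩ := hB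
  intro x
  rcases le_or_gt x.1.2 x.2.2 with hle | hgt
  · exact lengthCmp_pair_of_steps haLo haLo' haHi' hs0 hs1 hτ hhLo hhHi hconf hn hg₁ hg₂ hr hh hrn hstep hA hAC hC2
      hA' hAC' x hle
  · have h' := lengthCmp_pair_of_steps haLo haLo' haHi' hs0 hs1 hτ hhLo hhHi hconf hn hg₁ hg₂ hr hh hrn hstep hA hAC
      hC2 hA' hAC' (x.2, x.1) hgt.le
    rw [n9W_swap, norm_bondVec_swap] at h'
    exact h'

/-! ### §5 corollaries for the readers -/

/-- the PER-BOX CO-LIPSCHITZ CONSTANT from the slab box (ZZZYRCZL §2): letters in `{0,1,2}`, `0 ≤ c`, `2c² ≤ λ²`. [g100] -/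
theorem isLayeredCrystal_of_slabBox {wd : List ℤ} {aLo aHi s τ hLo hHi lam mu c : ℝ} {L : E3 ≃L[ℝ] E3} {w : ℤ → E3}
    (hB : SlabBoxW wd aLo aHi s τ hLo hHi L w) (h012 : ∀ l ∈ wd, 0 ≤ l ∧ l ≤ 2) (hc : 0 ≤ c) (hc2 : 2 * c ^ 2 ≤ lam ^ 2)
    (haLo : 0 < aLo) (hs0 : 0 ≤ s) (hs1 : s < 1) (hτ : 0 ≤ τ) (hhLo : 0 ≤ hLo) (hhHi : 0 ≤ hHi)
    (hA : lam ^ 2 < (1 - s) ^ 2 * aLo ^ 2)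
    (hAC : (1 - s) ^ 2 * τ ^ 2 * aLo ^ 4 ≤
      ((1 - s) ^ 2 * aLo ^ 2 - lam ^ 2) * ((τ ^ 2 + hLo ^ 2) * aLo ^ 2 - 2 / 3 * lam ^ 2))
    (hC2 : lam ^ 2 * (τ ^ 2 + 2 / 3 * (1 - s) ^ 2) ≤ hLo ^ 2 * (1 - s) ^ 2 * aLo ^ 2)
    (hA' : (1 + s) ^ 2 * aHi ^ 2 < mu ^ 2)
    (hAC' : (1 + s) ^ 2 * τ ^ 2 * aHi ^ 4 ≤
      (mu ^ 2 - (1 + s) ^ 2 * aHi ^ 2) * (2 / 3 * mu ^ 2 - (τ ^ 2 + hHi ^ 2) * aHi ^ 2)) :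
    IsLayeredCrystal c (gen₁ L) (gen₂ L) w :=
  isLayeredCrystal_of_idealLengthCmp h012 hc hc2 (idealLengthCmp_of_slabBox hB haLo hs0 hs1 hτ hhLo hhHi hA hAC hC2 hA' hAC')

/-- generator norms in the slab box: `‖gen_i L‖ ≤ (1+s)·aHi` (the `hgen` side condition of the readers). [g100] -/
theorem gen_norm_le_of_slabBox {wd : List ℤ} {aLo aHi s τ hLo hHi : ℝ} {L : E3 ≃L[ℝ] E3} {w : ℤ → E3}
    (hB : SlabBoxW wd aLo aHi s τ hLo hHi L w) (haLo : 0 ≤ aLo) (hs0 : 0 ≤ s) :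
    ‖gen₁ L‖ ≤ (1 + s) * aHi ∧ ‖gen₂ L‖ ≤ (1 + s) * aHi := by
  obtain ⟨a, n, r, h, haLo', haHi', hconf, -⟩ := hB
  have ha : 0 ≤ a := haLo.trans haLo'
  have h₁ : ‖(triangularVec₁ (1 : ℝ) : E3)‖ = 1 := by
    have := normSq_triangular_comb 1 0
    simp only [one_smul, zero_smul, add_zero] at this
    nlinarith [norm_nonneg (triangularVec₁ (1 : ℝ) : E3)]
  have h₂ : ‖(triangularVec₂ (1 : ℝ) : E3)‖ = 1 := by
    have := normSq_triangular_comb 0 1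
    simp only [one_smul, zero_smul, zero_add] at this
    nlinarith [norm_nonneg (triangularVec₂ (1 : ℝ) : E3)]
  have hb₁ := (norm_map_bounds_of_isConfChart ha hconf (triangularVec₁ 1)).2
  have hb₂ := (norm_map_bounds_of_isConfChart ha hconf (triangularVec₂ 1)).2
  rw [h₁, mul_one] at hb₁
  rw [h₂, mul_one] at hb₂
  have hs' : a + s * a ≤ (1 + s) * aHi := by nlinarith
  exact ⟨by simpa [gen₁] using hb₁.trans hs', by simpa [gen₂] using hb₂.trans hs'⟩

end Summit.AtomisticToContinuum.Crystallization.Theorems.ChartedZeroExcessLayeredLatticeLiouville
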